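import Summits.BirchSwinnertonDyer.Rank1Residual.GaloisImage.MultiplicativeCartanNormalizer
import Summits.BirchSwinnertonDyer.Rank1Residual.Partition.Rows
import HarnessLib

/-!
# Route `ErratumRoadFive` (rung K2), crux `NonSurjCorner` (item stmt-BirchSwinnertonDyer-19065):
# THE SHAPE OF THE CORNER — at every pair with `p ≥ 7` multiplicative, `E[p]` irreducible and
# `ρ̄_{E,p}` NOT onto, the image is contained in the normaliser of a SPLIT Cartan subgroup
# (through the inertia torus at `p`) and not in the Cartan subgroup; the index-2 «Cartan subgroup»
# `U ≤ Γ_ℚ` contains every inertia group at `p`, at every multiplicative and at every good prime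
# (cell `bsd-stepL`, seat `bsd-stepL-corner5-p2` g2, WIDTH-LEVER lane B «class-level road»;
# `--supports stmt-BirchSwinnertonDyer-19065 --as helper`)

WHY THIS FILE. The crux `NonSurjCorner` (∀ `(E,p)` in class X11b with `ρ̄_{E,p}` not onto, `p ∈ {5,7}`,
`p ∣ ord_p Δ_min`, no (ram) witness ⇒ `Typed.MissingPPartAt E p`) is attacked by lane A (seat `corner-p1`)
through Kolyvagin's structure theorem and was instanced per pair by this seat's g0 (three `p = 7` members).
This file records the CLASS-LEVEL structure of EVERY pair of its `p = 7` branch, assembled from the tree's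
Serre 1972 files and from x11c gen 7's `GaloisImage/MultiplicativeCartanNormalizer.lean` (whose
`exists_le_normalizer_splitCartan_of_mult_of_irr_of_not_surj` — `p ≥ 7`, `Mult ∧ Irr ∧ ¬Surj` ⇒ image in
the normaliser of the SPLIT Cartan through the inertia torus at `p`, not in it — is the starting point; no
definition, no named fact, no `sorry`). For `W/ℚ`, `p ≥ 7`, `Mult W p`, `Irr W p`, `¬ Surj W p`, a frame
`Φ : Aut(E[p]) ≅ GL₂(𝔽_p)`, `G = Φ(ρ̄(Γ_ℚ))`, `C = P (* 0; 0 *) P⁻¹` the split Cartan normalised by `G`: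

* §2 `p ∤ #G` ⇒ the inertia at every multiplicative `ℓ ≠ p` acts TRIVIALLY on `E[p]` (`¬ Ram`, Galois form,
  one place at a time, no semistability).
* §3 `exists_splitCartan_normalizer_of_mult_of_irr_of_not_surj`: x11c's shape theorem PLUS `p ∤ #G` PLUS
  «the inertia image of EVERY prime above `p` lies inside `C`» (Prop. 14 at each prime above `p`).
* §4 the «Cartan subgroup» `U = ρ̄⁻¹(Φ⁻¹(C)) ≤ Γ_ℚ` is open of index `2` and contains the inertia groups at
  `p`, at every multiplicative and every good `ℓ ≠ p`: the quadratic Cartan character is unramified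
  outside the ADDITIVE primes of `E`; and `E[p]` has two `U`-stable lines — over the quadratic Cartan field
  `K = ℚ̄^U` the curve acquires two `K`-rational `p`-isogenies: `p` is an EISENSTEIN prime of `E/K` (the
  «Eisenstein-over-`K`» reformulation of the `p = 7` branch; memo HOME/corner5/g2/CORNER5-P2-G2.md).
* §5 `NonSurjCorner.shape_seven` — all of it at the crux's `p = 7` hypotheses (`ClassX11b W 7`, `¬ Surj W 7`),
  and `NonSurjCorner.not_ram_not_semistable_seven` (`¬ Ram`, and an additive prime exists).

HONEST FRAMING: structure theorems about Galois images; nothing here proves the crux or a registered stub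
(`stub_corner5`, `stub_corner7`); BSD is proved for no class; nothing is booked. The `p = 5` branch
(`5Ns` / `5S4`) is NOT covered (Prop. 17 with a split half-Cartan needs `p ≠ 5`).

References: [Serre1972] §1.12 Cor., §2.1 a), §2.2 Prop. 14, §2.4 Prop. 15, §2.7 Prop. 17, §4.2 Lemme 2,
§5.2 (iii)–(iv), §5.4 proof of Prop. 21; [SilvermanATAEC1994] V.4–V.5; [Zywina2015] Thm. 1.5 (ℓ = 7);
tree files `GaloisImage/MultiplicativeCartanNormalizer`, `SemistableModPImageIrreducibleProofs`,
`SerreOpenImageNormalizerCaseProofs`, `SerreProp14GL2Fp`, `Rank1Residual/X9NoEntry`.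
-/
set_option linter.dupNamespace false -- `Summit.BirchSwinnertonDyer.BirchSwinnertonDyer` (summit = problem), tree-wide
noncomputable section
open scoped Classical NumberField
open IsDedekindDomain Field Matrix

namespace Summit.BirchSwinnertonDyer.BirchSwinnertonDyer.Theorems.CornerShape

open WeierstrassCurve NumberField Rat.HeightOneSpectrum
  Literature.NumberTheory.EllipticCurves Literature.NumberTheory.GaloisRepresentations
  Literature.NumberTheory.GaloisRepresentations.Serre1972
  Literature.NumberTheory.EllipticCurves.Rank1Residual
  Summit.BirchSwinnertonDyer.Rank1Residual Summit.BirchSwinnertonDyer.Rank1Residual.GaloisImage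

variable (W : WeierstrassCurve ℚ) [W.IsElliptic] (p : ℕ) [hp : Fact p.Prime]

/-! ### §2. Away from `p`: the inertia at a multiplicative `ℓ ≠ p` acts trivially when `p ∤ #G` -/

/-- **`p ∤ #ρ̄_{E,p}(Γ_ℚ)` ⇒ `E[p]` is unramified at every MULTIPLICATIVE `ℓ ≠ p`** (Serre §5.4, proof of
Prop. 21 (ii), one place at a time, no semistability): the inertia of `𝔓 ∣ ℓ` acts unipotently
(`smul_smul_sub_eq_of_mem_inertia_geomPoints`), hence with order dividing `p`, hence trivially. Galois
form of `¬ Ram W p` (`Rank1Residual.not_ram_of_irr_of_not_surj`).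
[cite: Serre1972, §5.4 Prop. 21 (ii) and its proof] [cite: SilvermanATAEC1994, V.4–V.5, Ex. 5.13 (b)] -/
theorem galoisRepTorsion_eq_one_of_mem_inertia_of_mult_ne
    (hG : ¬ p ∣ Nat.card (galoisRepTorsion W p).range)
    {ℓ : ℕ} [hℓ : Fact ℓ.Prime] (hℓp : ℓ ≠ p) (hmult : Mult W ℓ)
    {v : HeightOneSpectrum (𝓞 ℚ)} (hv : (primesEquiv v : ℕ) = ℓ)
    {𝔓 : Ideal (absIntegers (𝓞 ℚ) ℚ)} (h𝔓 : 𝔓 ∈ v.primesAbove)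
    {τ : absoluteGaloisGroup ℚ} (hτ : τ ∈ 𝔓.inertia (absoluteGaloisGroup ℚ)) :
    galoisRepTorsion W p τ = 1 := by
  have hpp : p.Prime := hp.out
  -- `W` is multiplicative at the place `v` of `ℓ`, and `p ∉ v`
  have hmult_v : haveI := Fact.mk (primesEquiv v).2;
      W.HasMultiplicativeReductionAtPrime (primesEquiv v) := by
    have key : ∀ (q : ℕ) (hq : Fact q.Prime), q = ℓ →
        @WeierstrassCurve.HasMultiplicativeReductionAtPrime W q hq := by
      rintro q hq rfl; exact hmult
    exact key _ _ hv
  have hmultAt : W.HasMultiplicativeReductionAt v :=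
    (hasMultiplicativeReductionAtPrime_iff_hasMultiplicativeReductionAt_ringOfIntegers W v).mp hmult_v
  have hpv : (p : 𝓞 ℚ) ∉ v.asIdeal := by
    intro hmem
    have hv' := (natCast_mem_asIdeal_iff_eq_primesEquiv_symm v hpp).mp hmem
    apply hℓp
    rw [← hv, hv', Equiv.apply_symm_apply]
  have hunip : ∀ Q : geomTorsion W p, τ • (τ • Q - Q) = τ • Q - Q := fun Q ↦ by
    have hQ : p ^ 1 • (Q : geomPoints W) = 0 := by
      rw [pow_one]
      have h := (mem_torsionPoints_iff _ _ (Q : geomPoints W)).mp Q.2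
      rwa [natCast_zsmul] at h
    have h := W.smul_smul_sub_eq_of_mem_inertia_geomPoints hmultAt hpp hpv le_rfl h𝔓 hτ hQ
    exact Subtype.ext (by
      simpa only [AddSubgroup.torsionBy.coe_smul, AddSubgroupClass.coe_sub] using h)
  have hpow := galoisRepTorsion_pow_prime_eq_one_of_unipotent W p hunip
  have h1 : orderOf (galoisRepTorsion W p τ) ∣ p := orderOf_dvd_of_pow_eq_one hpow
  have h2 : orderOf (galoisRepTorsion W p τ) ∣ Nat.card (galoisRepTorsion W p).range :=
    Subgroup.orderOf_dvd_natCard _ ⟨τ, rfl⟩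
  have hcop : Nat.Coprime p (Nat.card (galoisRepTorsion W p).range) :=
    (Nat.Prime.coprime_iff_not_dvd hpp).mpr hG
  exact orderOf_eq_one_iff.mp ((Nat.Coprime.coprime_dvd_left h1 hcop).eq_one_of_dvd h2)

section Frame

variable (Φ : Multiplicative (AddAut (geomTorsion W p)) ≃* GL (Fin 2) (ZMod p))
  (e : geomTorsion W p ≃+ (Fin 2 → ZMod p))
  (he : ∀ (g : Multiplicative (AddAut (geomTorsion W p))) (x : geomTorsion W p),
    e (Multiplicative.toAdd g x) =
      ((Φ g : GL (Fin 2) (ZMod p)) : Matrix (Fin 2) (Fin 2) (ZMod p)) *ᵥ e x)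

include he

/-! ### §3. The shape theorem: `G ≤ N(C)`, `G ⊄ C`, `C` the split Cartan of the inertia torus at `p` -/

/-- **THE SHAPE OF THE CORNER (`p ≥ 7`), with the inertia at `p` placed.** For `W/ℚ` elliptic, `p ≥ 7`
multiplicative, `E[p]` irreducible, `ρ̄_{E,p}` NOT onto, and a frame `Φ`: some `P ∈ GL₂(𝔽_p)` has
`P (1 0; 0 *) P⁻¹ ≤ G = Φ(ρ̄(Γ_ℚ)) ≤ N(C)`, `G ⊄ C` for the SPLIT Cartan `C = P (* 0; 0 *) P⁻¹` — this is
x11c gen 7's `GaloisImage.exists_le_normalizer_splitCartan_of_mult_of_irr_of_not_surj` (Prop. 15, 17, 14)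
— AND `p ∤ #G` (`not_dvd_card_of_not_hasSurjectiveModNGaloisRep`) AND the image of the inertia group of
EVERY prime `𝔏 ∣ p` of `ℤ̄` lies inside `C` (each is a split half-Cartan subgroup `≤ G ≤ N(C)`,
`GaloisImage.exists_halfSplitCartan_eq_inertia_image_of_mult`, hence `≤ C` by Prop. 14,
`prop14_halfSplitCartan`). The last clause is what makes the Cartan character unramified AT `p` (§4).
[cite: Serre1972, §2.2 Prop. 14, §2.4 Prop. 15, §2.7 Prop. 17, §5.4 proof of Prop. 21]
[cite: Zywina2015, Thm. 1.5 (ℓ = 7: the non-surjective irreducible images)] -/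
theorem exists_splitCartan_normalizer_of_mult_of_irr_of_not_surj (hp7 : 7 ≤ p) (hmult : Mult W p)
    (hirr : Irr W p) (hns : ¬ Surj W p) :
    ∃ P : GL (Fin 2) (ZMod p),
      halfSplitCartan P ≤ (galoisRepTorsion W p).range.map Φ.toMonoidHom ∧
      (galoisRepTorsion W p).range.map Φ.toMonoidHom ≤
          Subgroup.normalizer (splitCartan P : Set (GL (Fin 2) (ZMod p))) ∧
      ¬ (galoisRepTorsion W p).range.map Φ.toMonoidHom ≤ splitCartan P ∧
      ¬ p ∣ Nat.card ((galoisRepTorsion W p).range.map Φ.toMonoidHom) ∧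
      ∀ (v : HeightOneSpectrum (𝓞 ℚ)), (primesEquiv v : ℕ) = p →
        ∀ 𝔏 ∈ v.primesAbove,
          ((𝔏.inertia (absoluteGaloisGroup ℚ)).map (galoisRepTorsion W p)).map Φ.toMonoidHom ≤
            splitCartan P := by
  have hp2 : p ≠ 2 := by omega
  have h5 : 5 ≤ p := by omega
  set ρ := galoisRepTorsion W p with hρ
  set G : Subgroup (GL (Fin 2) (ZMod p)) := ρ.range.map Φ.toMonoidHom with hGdef
  have hpG : ¬ p ∣ Nat.card G :=
    not_dvd_card_of_not_hasSurjectiveModNGaloisRep W p Φ e he hirr hns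
  obtain ⟨P, hCG, hGN, hGC⟩ :=
    GaloisImage.exists_le_normalizer_splitCartan_of_mult_of_irr_of_not_surj W p Φ e he hp7 hmult hirr hns
  have hIle : ∀ {𝔏 : Ideal (absIntegers (𝓞 ℚ) ℚ)},
      ((𝔏.inertia (absoluteGaloisGroup ℚ)).map ρ).map Φ.toMonoidHom ≤ G := fun {𝔏} ↦
    Subgroup.map_mono (show (𝔏.inertia (absoluteGaloisGroup ℚ)).map ρ ≤ ρ.range from
      fun x ⟨τ, _, hτ⟩ ↦ ⟨τ, hτ⟩)
  refine ⟨P, hCG, hGN, hGC, hpG, fun v' hv' 𝔏 h𝔏 ↦ ?_⟩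
  obtain ⟨P', hP'⟩ :=
    GaloisImage.exists_halfSplitCartan_eq_inertia_image_of_mult W p Φ e he hp2 hmult hpG hv' h𝔏
  rw [hP']
  exact prop14_halfSplitCartan (splitCartan_mem_cartanSubgroups P) h5 (hP' ▸ (hIle.trans hGN))

/-! ### §4. The Cartan subgroup `U = ρ̄⁻¹(Φ⁻¹(C)) ≤ Γ_ℚ`: index `2`, unramified outside the additive primes -/

omit he in
/-- **The «Cartan subgroup» `U = ρ̄⁻¹(Φ⁻¹(C)) ≤ Γ_ℚ` is open of index `2`** when `G ≤ N(C)`, `G ⊄ C`,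
`C = P (* 0; 0 *) P⁻¹`, `p ≠ 2` (`(N : C) = 2`); its fixed field is the quadratic «Cartan field» `K`.
[cite: Serre1972, §2.2 and §4.2 c)] -/
theorem cartanSubgroup_index_two (hp2 : p ≠ 2) {P : GL (Fin 2) (ZMod p)}
    (hGN : (galoisRepTorsion W p).range.map Φ.toMonoidHom ≤
      Subgroup.normalizer (splitCartan P : Set (GL (Fin 2) (ZMod p))))
    (hGC : ¬ (galoisRepTorsion W p).range.map Φ.toMonoidHom ≤ splitCartan P) :
    IsOpen ((((splitCartan P).comap Φ.toMonoidHom).comap (galoisRepTorsion W p) :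
      Subgroup (absoluteGaloisGroup ℚ)) : Set (absoluteGaloisGroup ℚ)) ∧
    (((splitCartan P).comap Φ.toMonoidHom).comap (galoisRepTorsion W p)).index = 2 :=
  ⟨isOpen_comap_cartan W p Φ,
    index_comap_cartan_eq_two W p Φ (splitCartan_mem_cartanSubgroups P) (fun _ ↦ hp2) hGN hGC⟩

omit [W.IsElliptic] he in
/-- **`U` contains every inertia group above `p`** when the inertia images lie in `C` (last clause of the
shape theorem): the Cartan character is unramified at `p`. [cite: Serre1972, §2.2 Prop. 14; §5.4 proof of Prop. 21] -/
theorem inertia_le_cartanSubgroup_at {P : GL (Fin 2) (ZMod p)}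
    (hI : ∀ (v : HeightOneSpectrum (𝓞 ℚ)), (primesEquiv v : ℕ) = p →
      ∀ 𝔏 ∈ v.primesAbove,
        ((𝔏.inertia (absoluteGaloisGroup ℚ)).map (galoisRepTorsion W p)).map Φ.toMonoidHom ≤
          splitCartan P)
    {v : HeightOneSpectrum (𝓞 ℚ)} (hv : (primesEquiv v : ℕ) = p)
    {𝔏 : Ideal (absIntegers (𝓞 ℚ) ℚ)} (h𝔏 : 𝔏 ∈ v.primesAbove) :
    𝔏.inertia (absoluteGaloisGroup ℚ) ≤
      ((splitCartan P).comap Φ.toMonoidHom).comap (galoisRepTorsion W p) :=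
  fun τ hτ ↦ (mem_comap_cartan_iff W p Φ).mpr (hI v hv 𝔏 h𝔏 ⟨galoisRepTorsion W p τ, ⟨τ, hτ, rfl⟩, rfl⟩)

omit he in
/-- **`U` contains every inertia group above a MULTIPLICATIVE `ℓ ≠ p`** when `p ∤ #G` (§2): the Cartan
character is unramified at the multiplicative primes. [cite: Serre1972, §5.4 Prop. 21 (ii)] -/
theorem inertia_le_cartanSubgroup_mult {P : GL (Fin 2) (ZMod p)}
    (hG : ¬ p ∣ Nat.card ((galoisRepTorsion W p).range.map Φ.toMonoidHom))
    {ℓ : ℕ} [Fact ℓ.Prime] (hℓp : ℓ ≠ p) (hmult : Mult W ℓ)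
    {v : HeightOneSpectrum (𝓞 ℚ)} (hv : (primesEquiv v : ℕ) = ℓ)
    {𝔓 : Ideal (absIntegers (𝓞 ℚ) ℚ)} (h𝔓 : 𝔓 ∈ v.primesAbove) :
    𝔓.inertia (absoluteGaloisGroup ℚ) ≤
      ((splitCartan P).comap Φ.toMonoidHom).comap (galoisRepTorsion W p) := by
  have hGr : ¬ p ∣ Nat.card (galoisRepTorsion W p).range := by
    rwa [← card_map_range_galoisRepTorsion W p Φ]
  intro τ hτ
  rw [mem_comap_cartan_iff,
    galoisRepTorsion_eq_one_of_mem_inertia_of_mult_ne W p hGr hℓp hmult hv h𝔓 hτ, map_one]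
  exact (splitCartan P).one_mem

omit he in
/-- **`U` contains every inertia group above a GOOD `ℓ ≠ p`** (`E[p]` is unramified there, Néron–Ogg–
Shafarevich / Silverman VII.4.1; tree theorem `inertia_le_comap_cartan`). [cite: Serre1972, §4.2 Lemme 2] -/
theorem inertia_le_cartanSubgroup_good [W.IsGloballyMinimal] {P : GL (Fin 2) (ZMod p)}
    {ℓ : ℕ} [Fact ℓ.Prime] (hℓp : ℓ ≠ p) (hgood : Good W ℓ)
    {v : HeightOneSpectrum (𝓞 ℚ)} (hv : (primesEquiv v : ℕ) = ℓ)
    {𝔓 : Ideal (absIntegers (𝓞 ℚ) ℚ)} (h𝔓 : 𝔓 ∈ v.primesAbove) :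
    𝔓.inertia (absoluteGaloisGroup ℚ) ≤
      ((splitCartan P).comap Φ.toMonoidHom).comap (galoisRepTorsion W p) :=
  inertia_le_comap_cartan W p Φ hℓp hgood hv h𝔓

omit [W.IsElliptic] in
/-- **Two `U`-stable lines: `p` is an Eisenstein prime of `E` over the Cartan field.** For `σ ∈ U` the
lines `e⁻¹(𝔽_p · P eᵢ)` (`i = 0, 1`) of `E[p]` are `σ`-stable: over the fixed field `K` of `U`, `E/K` admits
two `K`-rational `p`-isogenies ("`sD₁ = D₁` et `sD₂ = D₂`", `mem_splitCartan_iff_col`). [cite: Serre1972, §2.1 a)] -/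
theorem cartanSubgroup_stable_lines {P : GL (Fin 2) (ZMod p)} {σ : absoluteGaloisGroup ℚ}
    (hσ : σ ∈ ((splitCartan P).comap Φ.toMonoidHom).comap (galoisRepTorsion W p))
    (i : Fin 2) (x : geomTorsion W p)
    (hx : ∃ a : ZMod p, e x = a • (P : Matrix (Fin 2) (Fin 2) (ZMod p)).col i) :
    ∃ b : ZMod p, e (σ • x) = b • (P : Matrix (Fin 2) (Fin 2) (ZMod p)).col i := by
  obtain ⟨a, ha⟩ := hx
  have hmem := mem_splitCartan_iff_col.mp ((mem_comap_cartan_iff W p Φ).mp hσ)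
  have hcol : ∃ c : ZMod p,
      ((Φ (galoisRepTorsion W p σ) : GL (Fin 2) (ZMod p)) : Matrix (Fin 2) (Fin 2) (ZMod p)) *ᵥ
          (P : Matrix (Fin 2) (Fin 2) (ZMod p)).col i =
        c • (P : Matrix (Fin 2) (Fin 2) (ZMod p)).col i := by
    fin_cases i
    · simpa using hmem.1
    · simpa using hmem.2
  obtain ⟨c, hc⟩ := hcol
  have h1 : σ • x = Multiplicative.toAdd (galoisRepTorsion W p σ) x := rfl
  exact ⟨a * c, by rw [h1, he, ha, Matrix.mulVec_smul, hc, smul_smul]⟩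

/-! ### §4b. The decomposition groups above `p` lie in `U`: `p` SPLITS in the Cartan field -/

omit he in
/-- **Group lemma: the normaliser of a split half-Cartan subgroup lies in its split Cartan subgroup**
(`|F| ≥ 3`): if `g` conjugates `P (1 0; 0 *) P⁻¹` into itself then `g ∈ P (* 0; 0 *) P⁻¹` — `g` must
preserve the two eigenlines of `P diag(1,u) P⁻¹`, `u ≠ 1`. (Entrywise: with `Q = P⁻¹ g P`, `M = Q D Q⁻¹`
diagonal with `M₀₀ = 1`, the identity `M Q = Q D` forces `Q` diagonal.) [folklore] -/
theorem mem_splitCartan_of_forall_conj_mem_halfSplitCartan {F : Type*} [Field F] {u : Fˣ}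
    (hu : u ≠ 1) {P g : GL (Fin 2) F}
    (hg : ∀ h ∈ halfSplitCartan P, g * h * g⁻¹ ∈ halfSplitCartan P) : g ∈ splitCartan P := by
  have hh : (MulAut.conj P).toMonoidHom (halfDiagonalHom u) ∈ halfSplitCartan P :=
    ⟨halfDiagonalHom u, by rw [← range_halfDiagonalHom]; exact ⟨u, rfl⟩, rfl⟩
  obtain ⟨hdg, h00⟩ := mem_halfSplitCartan_iff.mp (hg _ hh)
  obtain ⟨Q, hQ⟩ : ∃ Q : GL (Fin 2) F, P⁻¹ * g * P = Q := ⟨_, rfl⟩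
  obtain ⟨M, hM⟩ : ∃ M : GL (Fin 2) F, Q * halfDiagonalHom u * Q⁻¹ = M := ⟨_, rfl⟩
  have hconj : P⁻¹ * (g * (MulAut.conj P).toMonoidHom (halfDiagonalHom u) * g⁻¹) * P = M := by
    rw [← hM, ← hQ, MulEquiv.coe_toMonoidHom, MulAut.conj_apply]; group
  rw [hconj] at hdg h00
  have hMQ' : M * Q = Q * halfDiagonalHom u := by rw [← hM]; group
  have hMQ := congrArg (fun x : GL (Fin 2) F ↦ (x : Matrix (Fin 2) (Fin 2) F)) hMQ'
  simp only [Units.val_mul, coe_halfDiagonalHom] at hMQ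
  have hu1 : (u : F) ≠ 1 := fun h ↦ hu (Units.ext h)
  have e01 := congrFun (congrFun hMQ 0) 1
  have e10 := congrFun (congrFun hMQ 1) 0
  have e11 := congrFun (congrFun hMQ 1) 1
  simp only [Matrix.mul_apply, Fin.sum_univ_two, Matrix.diagonal, Matrix.of_apply,
    Matrix.cons_val_zero, Matrix.cons_val_one, hdg.1, hdg.2, h00, one_mul, zero_mul, mul_zero,
    mul_one, add_zero, zero_add, Fin.zero_eq_one_iff, if_true, if_false,
    OfNat.ofNat_ne_one, one_ne_zero] at e01 e10 e11
  -- `e01 : Q 0 1 = Q 0 1 * u`, `e10 : M 1 1 * Q 1 0 = Q 1 0`, `e11 : M 1 1 * Q 1 1 = Q 1 1 * u`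
  have hq01 : ((Q : GL (Fin 2) F) : Matrix (Fin 2) (Fin 2) F) 0 1 = 0 := by
    have : ((Q : GL (Fin 2) F) : Matrix (Fin 2) (Fin 2) F) 0 1 * (1 - (u : F)) = 0 := by
      rw [mul_sub, mul_one, sub_eq_zero]; exact e01
    rcases mul_eq_zero.mp this with h | h
    · exact h
    · exact absurd (sub_eq_zero.mp h).symm hu1
  have hq10 : ((Q : GL (Fin 2) F) : Matrix (Fin 2) (Fin 2) F) 1 0 = 0 := by
    by_contra hq10
    have hm11 : ((M : GL (Fin 2) F) : Matrix (Fin 2) (Fin 2) F) 1 1 = 1 :=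
      mul_right_cancel₀ hq10 (e10.trans (one_mul _).symm)
    rw [hm11, one_mul] at e11
    have hq11 : ((Q : GL (Fin 2) F) : Matrix (Fin 2) (Fin 2) F) 1 1 = 0 := by
      have : ((Q : GL (Fin 2) F) : Matrix (Fin 2) (Fin 2) F) 1 1 * (1 - (u : F)) = 0 := by
        rw [mul_sub, mul_one, sub_eq_zero]; exact e11
      rcases mul_eq_zero.mp this with h | h
      · exact h
      · exact absurd (sub_eq_zero.mp h).symm hu1
    apply GL2.det_ne_zero Q
    rw [Matrix.det_fin_two, hq01, hq11, mul_zero, zero_mul, sub_zero]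
  exact mem_splitCartan_iff.mpr (hQ ▸ ⟨hq01, hq10⟩)

/-- **The normaliser of each inertia group above `p` lies in `U`; in particular so does the
decomposition group `D_𝔏` (which normalises `I_𝔏`): `p` SPLITS COMPLETELY in the quadratic Cartan
field `K`** — at the shape of §3 (`G ≤ N(C)`, `C = P (* 0; 0 *) P⁻¹`, `p ∤ #G`, `p ≥ 7` multiplicative):
`Φ(ρ̄(I_𝔏))` is a split half-Cartan subgroup `P' (1 0; 0 *) P'⁻¹` whose split Cartan is `C` (Prop. 14),
and an element conjugating it into itself lies in `C` (`mem_splitCartan_of_forall_conj_mem_halfSplitCartan`).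
So over `K` the prime `p` splits and `E[p]|_{Γ_K}` is the sum of two lines on each of which the local
Galois group at `p` acts by a character: the Eisenstein-over-`K` picture of CGLS 2022 / Keller–Yin 2024,
here with `p ∣ N` multiplicative and `p` split in `K`. [cite: Serre1972, §2.2 Prop. 14; §1.12 Cor.] -/
theorem normalizer_inertia_le_cartanSubgroup (hp7 : 7 ≤ p) (hmult : Mult W p) {P : GL (Fin 2) (ZMod p)}
    (hGN : (galoisRepTorsion W p).range.map Φ.toMonoidHom ≤
      Subgroup.normalizer (splitCartan P : Set (GL (Fin 2) (ZMod p))))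
    (hG : ¬ p ∣ Nat.card ((galoisRepTorsion W p).range.map Φ.toMonoidHom))
    {v : HeightOneSpectrum (𝓞 ℚ)} (hv : (primesEquiv v : ℕ) = p)
    {𝔏 : Ideal (absIntegers (𝓞 ℚ) ℚ)} (h𝔏 : 𝔏 ∈ v.primesAbove) {g : absoluteGaloisGroup ℚ}
    (hg : ∀ τ ∈ 𝔏.inertia (absoluteGaloisGroup ℚ), g * τ * g⁻¹ ∈ 𝔏.inertia (absoluteGaloisGroup ℚ)) :
    g ∈ ((splitCartan P).comap Φ.toMonoidHom).comap (galoisRepTorsion W p) := by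
  have hp2 : p ≠ 2 := by omega
  have h5 : 5 ≤ p := by omega
  obtain ⟨u, hu⟩ := exists_units_ne_one hp2
  set ρ := galoisRepTorsion W p with hρ
  obtain ⟨P', hP'⟩ :=
    GaloisImage.exists_halfSplitCartan_eq_inertia_image_of_mult W p Φ e he hp2 hmult hG hv h𝔏
  have hIle : ((𝔏.inertia (absoluteGaloisGroup ℚ)).map ρ).map Φ.toMonoidHom ≤
      ρ.range.map Φ.toMonoidHom :=
    Subgroup.map_mono (show (𝔏.inertia (absoluteGaloisGroup ℚ)).map ρ ≤ ρ.range from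
      fun x ⟨τ, _, hτ⟩ ↦ ⟨τ, hτ⟩)
  have hPP' : splitCartan P = splitCartan P' :=
    eq_splitCartan_of_halfSplitCartan_le_normalizer (splitCartan_mem_cartanSubgroups P) h5
      (hP' ▸ (hIle.trans hGN))
  have hnorm : ∀ h ∈ halfSplitCartan P', Φ (ρ g) * h * (Φ (ρ g))⁻¹ ∈ halfSplitCartan P' := by
    intro h hh
    rw [← hP'] at hh ⊢
    obtain ⟨x, ⟨τ, hτ, rfl⟩, rfl⟩ := hh
    refine ⟨ρ (g * τ * g⁻¹), ⟨g * τ * g⁻¹, hg τ hτ, rfl⟩, ?_⟩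
    simp only [MulEquiv.coe_toMonoidHom, map_mul, map_inv, hρ]
  rw [mem_comap_cartan_iff, hPP']
  exact mem_splitCartan_of_forall_conj_mem_halfSplitCartan hu hnorm

end Frame

/-! ### §5. At the crux's `p = 7` branch -/

/-- **THE SHAPE OF THE `p = 7` CORNER** (crux `NonSurjCorner` ∕ `stub_corner7`: `ClassX11b W 7`,
`¬ Surj W 7`): for every frame `(Φ, e)` some `P ∈ GL₂(𝔽₇)` gives, with `C = P (* 0; 0 *) P⁻¹`,
`U = ρ̄⁻¹(Φ⁻¹(C))`: (1) `G ≤ N(C)`, `G ⊄ C`, `7 ∤ #G` (normaliser of a SPLIT Cartan; never exceptional,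
never non-split); (2) `U` open of index `2` (the quadratic Cartan field `K`); (3) `U` contains the inertia
groups above `7` — and the normaliser of each, hence the decomposition groups: `7` SPLITS in `K` —,
above every multiplicative `ℓ ≠ 7` and every good `ℓ` — the Cartan character ramifies only at ADDITIVE
primes (which exist: `not_ram_not_semistable_seven`); (4) the lines `e⁻¹(𝔽₇ · P eᵢ)` are
`U`-stable — `7` is an Eisenstein prime of `E/K`. The crux binders `7 ∣ ord₇ Δ_min`, `¬ Ram W 7` are not
used. Nothing about BSD is claimed. [cite: Serre1972, §2.2 Prop. 14, §2.7 Prop. 17, §5.4 proof of Prop. 21]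
[cite: Zywina2015, Thm. 1.5 (ℓ = 7)] -/
theorem NonSurjCorner.shape_seven (W : WeierstrassCurve ℚ) [W.IsElliptic] [W.IsGloballyMinimal]
    [Fact (Nat.Prime 7)] (hX : ClassX11b W 7) (hns : ¬ Surj W 7)
    (Φ : Multiplicative (AddAut (geomTorsion W 7)) ≃* GL (Fin 2) (ZMod 7))
    (e : geomTorsion W 7 ≃+ (Fin 2 → ZMod 7))
    (he : ∀ (g : Multiplicative (AddAut (geomTorsion W 7))) (x : geomTorsion W 7),
      e (Multiplicative.toAdd g x) =
        ((Φ g : GL (Fin 2) (ZMod 7)) : Matrix (Fin 2) (Fin 2) (ZMod 7)) *ᵥ e x) :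
    ∃ P : GL (Fin 2) (ZMod 7),
      ((galoisRepTorsion W 7).range.map Φ.toMonoidHom ≤
          Subgroup.normalizer (splitCartan P : Set (GL (Fin 2) (ZMod 7))) ∧
        ¬ (galoisRepTorsion W 7).range.map Φ.toMonoidHom ≤ splitCartan P ∧
        ¬ 7 ∣ Nat.card ((galoisRepTorsion W 7).range.map Φ.toMonoidHom)) ∧
      (IsOpen ((((splitCartan P).comap Φ.toMonoidHom).comap (galoisRepTorsion W 7) :
          Subgroup (absoluteGaloisGroup ℚ)) : Set (absoluteGaloisGroup ℚ)) ∧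
        (((splitCartan P).comap Φ.toMonoidHom).comap (galoisRepTorsion W 7)).index = 2) ∧
      (∀ (v : HeightOneSpectrum (𝓞 ℚ)), (primesEquiv v : ℕ) = 7 → ∀ 𝔏 ∈ v.primesAbove,
        𝔏.inertia (absoluteGaloisGroup ℚ) ≤
          ((splitCartan P).comap Φ.toMonoidHom).comap (galoisRepTorsion W 7) ∧
        ∀ g : absoluteGaloisGroup ℚ, (∀ τ ∈ 𝔏.inertia (absoluteGaloisGroup ℚ),
            g * τ * g⁻¹ ∈ 𝔏.inertia (absoluteGaloisGroup ℚ)) →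
          g ∈ ((splitCartan P).comap Φ.toMonoidHom).comap (galoisRepTorsion W 7)) ∧
      (∀ (ℓ : ℕ) [Fact ℓ.Prime], ℓ ≠ 7 → (Mult W ℓ ∨ Good W ℓ) →
        ∀ (v : HeightOneSpectrum (𝓞 ℚ)), (primesEquiv v : ℕ) = ℓ → ∀ 𝔓 ∈ v.primesAbove,
          𝔓.inertia (absoluteGaloisGroup ℚ) ≤
            ((splitCartan P).comap Φ.toMonoidHom).comap (galoisRepTorsion W 7)) ∧
      (∀ σ ∈ ((splitCartan P).comap Φ.toMonoidHom).comap (galoisRepTorsion W 7),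
        ∀ (i : Fin 2) (x : geomTorsion W 7),
          (∃ a : ZMod 7, e x = a • (P : Matrix (Fin 2) (Fin 2) (ZMod 7)).col i) →
            ∃ b : ZMod 7, e (σ • x) = b • (P : Matrix (Fin 2) (Fin 2) (ZMod 7)).col i) := by
  obtain ⟨P, -, hGN, hGC, hpG, hI⟩ := exists_splitCartan_normalizer_of_mult_of_irr_of_not_surj W 7 Φ e
    he (le_refl 7) hX.2.2.1 hX.2.2.2 hns
  refine ⟨P, ⟨hGN, hGC, hpG⟩, cartanSubgroup_index_two W 7 Φ (by norm_num) hGN hGC,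
    fun v hv 𝔏 h𝔏 ↦ ⟨inertia_le_cartanSubgroup_at W 7 Φ hI hv h𝔏, fun g hg ↦
      normalizer_inertia_le_cartanSubgroup W 7 Φ e he (le_refl 7) hX.2.2.1 hGN hpG hv h𝔏 hg⟩,
    fun ℓ _ hℓ hred v hv 𝔓 h𝔓 ↦ ?_,
    fun σ hσ i x hx ↦ cartanSubgroup_stable_lines W 7 Φ e he hσ i x hx⟩
  rcases hred with hmult | hgood
  · exact inertia_le_cartanSubgroup_mult W 7 Φ hpG hℓ hmult hv h𝔓
  · exact inertia_le_cartanSubgroup_good W 7 Φ hℓ hgood hv h𝔓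

/-- **The `p = 7` corner has no (ram) witness and is not semistable**: `¬ Ram W 7` FOLLOWS from
`Irr ∧ ¬Surj` (`not_ram_of_irr_of_not_surj`), and the curve has an ADDITIVE prime (Serre Prop. 21,
`not_semistable_of_irr_of_not_surj`) — where the Cartan character ramifies. [cite: Serre1972, §5.4 Prop. 21 i)] -/
theorem NonSurjCorner.not_ram_not_semistable_seven (W : WeierstrassCurve ℚ) [W.IsElliptic]
    [W.IsGloballyMinimal] [Fact (Nat.Prime 7)] (hX : ClassX11b W 7) (hns : ¬ Surj W 7) :
    ¬ Ram W 7 ∧ ¬ Semistable W :=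
  ⟨not_ram_of_irr_of_not_surj W 7 hX.2.2.2 hns, not_semistable_of_irr_of_not_surj W 7 hX.2.2.2 hns⟩

end Summit.BirchSwinnertonDyer.BirchSwinnertonDyer.Theorems.CornerShape

end
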